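import Mathlib
import Summits.QuantumFields.BalabanUV.Beta.UnitLatticeLocalInverse

/-!
# `Summit.QuantumFields.BalabanUV.Beta.UnitLatticeWalkInversionDecay` — ASSEMBLY: the unit-lattice walk inversion of
# `1 + K′` from hypotheses on `K′` ALONE (exponential decay `‖K′(i,j)‖ ≤ θe^{−κ₀d(i,j)}`, `Re`-coercivity `m₀` of `1 + K′`,
# lattice-sum profiles) and on the scale-`M` partition of unity — the local inverses are CONSTRUCTED
# (`UnitLatticeLocalInverse`) and fed to the spine (`UnitLatticeWalkInversion`)

HONEST FRAMING (page 1 of everything in this cell).  Discharging `FlowStep.BetaPertH` would make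
Bałaban's ultraviolet stability UNCONDITIONAL — a constructive-QFT result; it is NOT the continuum
limit and NOT the Clay problem.  This module discharges nothing of `BetaPertH`; [folklore] linear algebra,
kernel-checked (unit `b2b-balaban-beta-d4-p3`, road P3 «reduction road», gen 3; kernel leaf A3-assembly of the road's
re-cut of NODE A, skeleton v1.5 §7; owner's route A.3′ of `OUTLINE-D4-NODE-A.md`).
HONEST DEPENDENCY: continuum YM on T⁴ ⇐ BetaPertH ∧ nine spine estimates (0/9 proved); BetaPertH ⇐
(D1) ∧ (D4) ∧ CAP+tail; G-an2-4 gates asym, D1 and NE2/3/4.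

THE STATEMENT (`walkInversion_of_decay`).  Data: a finite index set `Y` with a SYMMETRIC pseudo-metric `d` and a rate
`κ ≥ 0` (`B13PerturbativeStep.WeightHyp`); a kernel `K′` with `‖K′(i,j)‖ ≤ θe^{−κ₀d(i,j)}` and `1 + K′` `Re`-coercive with
`m₀ > 0`; the profiles `Σ_j d(i,j)e^{−(κ₀−κ₁)d(i,j)} ≤ L₁` (first moment, at the local-inverse rate `κ₁ ≥ κ`) and
`Σ_j e^{−(κ₁−κ)d(i,j)} ≤ L` ; cubes `□̃ = E b` with partition functions `h_□` (`Σh² = 1`, support, `|h| ≤ 1`, `d/M`-Lipschitz,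
overlap `N`).  IF the local-inverse budget closes, `κ₁θL₁ < m₀` (the conjugation cost of `K′` at rate `κ₁` — LINEAR in
`κ₁`, so always achievable by taking `κ₁` small: «constants depending on γ₁», read `θ = xθ_K ≤ 2γ₁θ_K`), AND the walk
budget closes, `(2N/M)·(L/(m₀ − κ₁θL₁))·(θL₁) < 1` («M sufficiently large»), THEN `1 + K′` is invertible,
`(1 + K′)⁻¹ = Ptot·(1 − R)⁻¹` with the CONSTRUCTED local inverses `L_□ = extend((compress (1 + K′) □̃)⁻¹)`, and
`WRS κ d (1 + K′)⁻¹ (N·C_L·(1 − ρ)⁻¹)`; the walk expansion to every order is `UnitLatticeWalkInversion.inv_one_add_eq_sum`.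
WHAT IS NOT HERE: the U-localisation refinement; any instance (which `K`, which cubes).  NOT summit progress.

ABSOLUTE RULE.  Nothing printed is cited; nothing restated (BY NAME: the two companions, `AccretiveCombesThomas(Budget)`,
`B13PerturbativeStep`).
-/

open scoped BigOperators Matrix ComplexConjugate
open Finset Matrix

namespace Summit.QuantumFields.BalabanUV.Beta.UnitLatticeWalkInversionDecay

open Summit.QuantumFields.BalabanUV.Beta.AccretiveCombesThomas
open Summit.QuantumFields.BalabanUV.Beta.AccretiveCombesThomasBudget
open Summit.QuantumFields.BalabanUV.Beta.UnitLatticeWalkInversion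
open Summit.QuantumFields.BalabanUV.Beta.UnitLatticeLocalInverse
open Literature.MathematicalPhysics.QuantumFieldTheory.Balaban1983to89.B5Prop11Lower (nsq nsq_nonneg)
open Literature.MathematicalPhysics.QuantumFieldTheory.Balaban1983to89.B13PerturbativeStep (wrs WRS WeightHyp)

noncomputable section

variable {Y : Type*} [Fintype Y] [DecidableEq Y]

/-! ## §1 The identity costs nothing; the compression of `1 + K′` -/

/-- The conjugated form of the identity is `‖z‖²`: conjugation costs the identity NOTHING. [folklore] -/
theorem conjForm_one (κ : ℝ) (ρ : Y → ℝ) (z : Y → ℂ) : conjForm (1 : Matrix Y Y ℂ) κ ρ z = ((nsq z : ℝ) : ℂ) := by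
  unfold conjForm nsq
  rw [Complex.ofReal_sum]
  refine Finset.sum_congr rfl fun e _ => ?_
  rw [Finset.sum_eq_single e (fun e' _ he' => by simp [Ne.symm he']) (by simp)]
  rw [Matrix.one_apply_eq, sub_self, mul_zero, Real.exp_zero, Complex.ofReal_one, mul_one, mul_one,
    Complex.conj_mul', Complex.ofReal_pow]

omit [DecidableEq Y] in
/-- A subtype sum of nonnegative terms is at most the full sum. [folklore] -/
theorem sum_subtype_le_sum (S : Finset Y) (f : Y → ℝ) (hf : ∀ y, 0 ≤ f y) : ∑ k : S, f k ≤ ∑ k, f k := by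
  rw [Finset.sum_coe_sort S f]
  exact Finset.sum_le_sum_of_subset_of_nonneg (Finset.subset_univ S) fun k _ _ => hf k

/-- The identity's budget: `Re z^*(1·z) − 0·‖z‖² ≤ Re conjForm 1`. [folklore] -/
theorem conjLower_one (κ : ℝ) (ρ : Y → ℝ) (z : Y → ℂ) :
    (star z ⬝ᵥ ((1 : Matrix Y Y ℂ) *ᵥ z)).re - 0 * nsq z ≤ (conjForm (1 : Matrix Y Y ℂ) κ ρ z).re := by
  rw [conjForm_one, Complex.ofReal_re, zero_mul, sub_zero, Matrix.one_mulVec,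
    Literature.MathematicalPhysics.QuantumFieldTheory.Balaban1983to89.B5Prop11Lower.star_dotProduct_self,
    Complex.ofReal_re]

omit [Fintype Y] in
/-- `compress (1 + K′) S = 1 + compress K′ S`. [folklore] -/
theorem compress_one_add (K' : Matrix Y Y ℂ) (S : Finset Y) : compress (1 + K') S = 1 + compress K' S := by
  ext i j
  simp only [compress, Matrix.submatrix_apply, Matrix.add_apply, Matrix.one_apply]
  by_cases hij : i = j
  · subst hij; simp
  · have : (i : Y) ≠ (j : Y) := fun h => hij (Subtype.ext h)
    simp [hij, this]

/-! ## §2 Conjugated coercivity of the compressed local operators, from decay -/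

/-- **Local conjugated coercivity from decay**: `‖K′(i,j)‖ ≤ θe^{−κ₀d}`, `1 + K′` `Re`-coercive (`m₀`), `d` symmetric,
first-moment profile `L₁` at rate `κ₁ ≥ 0` ⇒ the compression of `1 + K′` to ANY cube is conjugated-coercive with
`m₀ − κ₁θL₁` along every weight `k ↦ d(k, j)` (budget: identity 0 + Schur `½(κ₁θL₁ + κ₁θL₁)`). [folklore] -/
theorem conjCoercive_compress_of_decay (K' : Matrix Y Y ℂ) (S : Finset Y) {d : Y → Y → ℝ} {κ : ℝ}
    (hw : WeightHyp κ d)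
    (hds : ∀ i j, d i j = d j i) {κ₀ κ₁ θ L₁ m₀ : ℝ} (hκ₁ : 0 ≤ κ₁) (hθ : 0 ≤ θ)
    (hK : ∀ i j, ‖K' i j‖ ≤ θ * Real.exp (-(κ₀ * d i j)))
    (hRe : ∀ z : Y → ℂ, m₀ * nsq z ≤ (star z ⬝ᵥ ((1 + K') *ᵥ z)).re)
    (hL₁ : ∀ i, ∑ j, d i j * Real.exp (-((κ₀ - κ₁) * d i j)) ≤ L₁) (j : S) (z : S → ℂ) :
    (m₀ - κ₁ * θ * L₁) * nsq z ≤ (conjForm (compress (1 + K') S) κ₁ (fun k : S => d k j) z).re := by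
  -- weights k ↦ d(k,j) are d-Lipschitz on the subtype
  have hρ : ∀ e e' : S, |d (e : Y) j - d (e' : Y) j| ≤ d (e : Y) (e' : Y) := by
    intro e e'
    rw [abs_sub_le_iff]
    constructor
    · linarith [hw.tri (e : Y) (e' : Y) (j : Y)]
    · linarith [hw.tri (e' : Y) (e : Y) (j : Y), hds (e : Y) (e' : Y)]
  have hKc : ∀ e e' : S, ‖compress K' S e e'‖ ≤ θ * Real.exp (-(κ₀ * d (e : Y) (e' : Y))) :=
    fun e e' => hK e e'
  have hrow : ∀ e : S, expRowDefect (compress K' S) κ₁ (fun k : S => d k j) e ≤ κ₁ * θ * L₁ := by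
    intro e
    refine expRowDefect_le_of_decay_linear (compress K' S) hκ₁ hθ _ (fun e e' : S => d (e : Y) (e' : Y)) hρ hKc
      (fun e => ?_) e
    exact (sum_subtype_le_sum S (fun e' : Y => d (e : Y) e' * Real.exp (-((κ₀ - κ₁) * d (e : Y) e')))
      (fun e' => mul_nonneg (hw.nonneg _ _) (Real.exp_pos _).le)).trans (hL₁ e)
  have hcol : ∀ e' : S, expColDefect (compress K' S) κ₁ (fun k : S => d k j) e' ≤ κ₁ * θ * L₁ := by
    intro e'
    refine expColDefect_le_of_decay_linear (compress K' S) hκ₁ hθ _ (fun e e' : S => d (e : Y) (e' : Y)) hρ hKc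
      (fun e' => ?_) e'
    calc ∑ e : S, d (e : Y) (e' : Y) * Real.exp (-((κ₀ - κ₁) * d (e : Y) (e' : Y)))
        = ∑ e : S, d (e' : Y) (e : Y) * Real.exp (-((κ₀ - κ₁) * d (e' : Y) (e : Y))) :=
          Finset.sum_congr rfl fun e _ => by rw [hds (e : Y) (e' : Y)]
      _ ≤ ∑ e : Y, d (e' : Y) e * Real.exp (-((κ₀ - κ₁) * d (e' : Y) e)) :=
          sum_subtype_le_sum S (fun e : Y => d (e' : Y) e * Real.exp (-((κ₀ - κ₁) * d (e' : Y) e)))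
            (fun e => mul_nonneg (hw.nonneg _ _) (Real.exp_pos _).le)
      _ ≤ L₁ := hL₁ e'
  -- budget of 1 + compress K′: 0 + ½(κ₁θL₁ + κ₁θL₁)
  have hbudget := conjLower_add (conjLower_one κ₁ (fun k : S => d k j))
    (conjLower_of_expDefect (compress K' S) κ₁ (fun k : S => d k j) hrow hcol)
  have hγ : ∀ w : S → ℂ, m₀ * nsq w ≤ (star w ⬝ᵥ ((1 + compress K' S) *ᵥ w)).re := fun w => by
    rw [← compress_one_add]; exact reCoercive_compress (1 + K') hRe w
  have h := conjCoercive_of_conjLower hγ hbudget z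
  rw [compress_one_add]
  have : m₀ - (0 + (κ₁ * θ * L₁ + κ₁ * θ * L₁) / 2) = m₀ - κ₁ * θ * L₁ := by ring
  rw [this] at h
  exact h

/-! ## §3 The constructed local inverses and the assembled walk inversion -/

/-- THE CONSTRUCTED LOCAL INVERSE on the cube `□̃ = E b`: `extend((compress (1 + K′) □̃)⁻¹)`. [folklore] -/
def locInv {B : Type*} (K' : Matrix Y Y ℂ) (E : B → Finset Y) (b : B) : Matrix Y Y ℂ :=
  extend ((compress (1 + K') (E b))⁻¹)

omit [DecidableEq Y] in
/-- The first exponential moment of a decaying kernel at rate `κ ≤ κ₁`: `Σ_j ‖K′(i,j)‖ d(i,j) e^{κd(i,j)} ≤ θ·L₁`.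
[folklore] -/
theorem firstMoment_le_of_decay (K' : Matrix Y Y ℂ) {d : Y → Y → ℝ} (hd : ∀ i j, 0 ≤ d i j) {κ κ₀ κ₁ θ L₁ : ℝ}
    (hκκ₁ : κ ≤ κ₁) (hθ : 0 ≤ θ) (hK : ∀ i j, ‖K' i j‖ ≤ θ * Real.exp (-(κ₀ * d i j)))
    (hL₁ : ∀ i, ∑ j, d i j * Real.exp (-((κ₀ - κ₁) * d i j)) ≤ L₁) (i : Y) :
    ∑ j, ‖K' i j‖ * d i j * Real.exp (κ * d i j) ≤ θ * L₁ := by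
  calc ∑ j, ‖K' i j‖ * d i j * Real.exp (κ * d i j)
      ≤ ∑ j, θ * (d i j * Real.exp (-((κ₀ - κ₁) * d i j))) := by
        refine Finset.sum_le_sum fun j _ => ?_
        have h1 : Real.exp (-(κ₀ * d i j)) * Real.exp (κ * d i j) ≤ Real.exp (-((κ₀ - κ₁) * d i j)) := by
          rw [← Real.exp_add]
          exact Real.exp_le_exp.2 (by nlinarith [hd i j])
        calc ‖K' i j‖ * d i j * Real.exp (κ * d i j)
            ≤ θ * Real.exp (-(κ₀ * d i j)) * d i j * Real.exp (κ * d i j) := by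
              have := hK i j
              have h0 : 0 ≤ d i j * Real.exp (κ * d i j) := mul_nonneg (hd i j) (Real.exp_pos _).le
              nlinarith
          _ = θ * (d i j * (Real.exp (-(κ₀ * d i j)) * Real.exp (κ * d i j))) := by ring
          _ ≤ θ * (d i j * Real.exp (-((κ₀ - κ₁) * d i j))) :=
              mul_le_mul_of_nonneg_left (mul_le_mul_of_nonneg_left h1 (hd i j)) hθ
    _ = θ * ∑ j, d i j * Real.exp (-((κ₀ - κ₁) * d i j)) := (Finset.mul_sum _ _ _).symm
    _ ≤ θ * L₁ := mul_le_mul_of_nonneg_left (hL₁ i) hθ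

/-- **THE UNIT-LATTICE WALK INVERSION FROM DECAY** (assembly; statement in the module docstring). [folklore] -/
theorem walkInversion_of_decay {B : Type*} [Fintype B] {d : Y → Y → ℝ} {κ : ℝ} (hw : WeightHyp κ d)
    (hds : ∀ i j, d i j = d j i) (K' : Matrix Y Y ℂ) (h : B → Y → ℝ) (E : B → Finset Y)
    (hsum : ∀ y, ∑ b, h b y ^ 2 = 1) (hsupp : ∀ b y, y ∉ E b → h b y = 0) (habs : ∀ b y, |h b y| ≤ 1)
    {M N θ κ₀ κ₁ L₁ L m₀ : ℝ} (hM : 0 < M) (hLip : ∀ b y y', |h b y - h b y'| ≤ d y y' / M)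
    (hN : ∀ y, ((Finset.univ.filter fun b => y ∈ E b).card : ℝ) ≤ N) (hθ : 0 ≤ θ) (hκκ₁ : κ ≤ κ₁)
    (hK : ∀ i j, ‖K' i j‖ ≤ θ * Real.exp (-(κ₀ * d i j)))
    (hm₀ : 0 < m₀) (hRe : ∀ z : Y → ℂ, m₀ * nsq z ≤ (star z ⬝ᵥ ((1 + K') *ᵥ z)).re)
    (hL₁ : ∀ i, ∑ j, d i j * Real.exp (-((κ₀ - κ₁) * d i j)) ≤ L₁)
    (hL : ∀ i, ∑ j, Real.exp (-((κ₁ - κ) * d i j)) ≤ L) (hL0 : 0 ≤ L)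
    (hm : κ₁ * θ * L₁ < m₀) (hρ : 2 * N / M * ((m₀ - κ₁ * θ * L₁)⁻¹ * L) * (θ * L₁) < 1) :
    IsUnit (1 + K') ∧ (1 + K')⁻¹ = Ptot h (locInv K' E) * (1 - Rem h K' (locInv K' E))⁻¹
      ∧ WRS κ d (1 + K')⁻¹
          (N * ((m₀ - κ₁ * θ * L₁)⁻¹ * L) * (1 - 2 * N / M * ((m₀ - κ₁ * θ * L₁)⁻¹ * L) * (θ * L₁))⁻¹) := by
  have hκ₁ : 0 ≤ κ₁ := hw.κ_nonneg.trans hκκ₁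
  have hmpos : 0 < m₀ - κ₁ * θ * L₁ := sub_pos.2 hm
  have hC : 0 ≤ (m₀ - κ₁ * θ * L₁)⁻¹ * L := mul_nonneg (inv_nonneg.2 hmpos.le) hL0
  -- the constructed local inverses: budget, support, local-inverse property
  have hLb : ∀ b, WRS κ d (locInv K' E b) ((m₀ - κ₁ * θ * L₁)⁻¹ * L) := fun b =>
    wrs_extend_inv_le (E b) (1 + K') d hw.zero hκ₁ hmpos hL0
      (fun j z => conjCoercive_compress_of_decay K' (E b) hw hds hκ₁ hθ hK hRe hL₁ j z) hL
  have hPL : ∀ b, Pj E b * locInv K' E b = locInv K' E b := fun b => Pj_mul_extend E b _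
  have hinv : ∀ b, Pj E b * (1 + K') * Pj E b * locInv K' E b = Pj E b := fun b =>
    Pj_mul_mul_Pj_mul_extend_inv E b (1 + K')
      (isUnit_of_reCoercive hm₀ (reCoercive_compress (1 + K') hRe))
  have hK₁ := firstMoment_le_of_decay K' hw.nonneg hκκ₁ hθ hK hL₁
  exact walkInversion hw K' h E (locInv K' E) hsum hsupp habs hM hLip hN hC hLb hPL hinv hK₁ hρ

end

end Summit.QuantumFields.BalabanUV.Beta.UnitLatticeWalkInversionDecay
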